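import Literature.Combinatorics.Sahi2008.CycleForm
import Summits.CriticalPhenomena.PercolationContinuityZ3.Theorems.PercNearOneGluingNoHeavyLowerTailSahiSlotPatternBridge

/-!
# The all-order ZERO LOCUS at the value level: `E_n` vanishes on fully independent families (`n ≥ 2`, every weight of mass one)

Support file (lane `prim-masterthm-p3`, generation 18; `--supports stmt-CriticalPhenomena-4575`).  Pure proofs, no definitions,
no `sorry`, standard axioms.

If all joint moments of `f_0, …, f_{n+1}` factor (`E[Π_{j∈B} f_j] = Π_{j∈B} E[f_j]` for every `B`) under a weight of total mass `1`,
then in the cycle form every `E_σ(f)` equals `Π_j E[f_j]` (the cycles partition the slots, `prod_eq_prod_orbits_indep`), so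
  `E_{n+2}(f) = (Π_j E[f_j]) · E_{n+2}(1, …, 1) = 0`            (`sahiE_eq_prod_ex_mul_const`, `sahiE_eq_zero_of_indep`; `sahiE_const_one`).
This is the value-level, all-order form of the zero locus: for a product weight on a grid, indicators of CYLINDERS over pairwise
disjoint sets of axes are fully independent, so `E_n` vanishes there — the configurations on which the adversarial minimisers of the
open cell `(3,4)` accumulate (lane HIERARCHY §26(l),(q)). [this work]
-/

namespace Summit.CriticalPhenomena.PercolationContinuityZ3.Theorems

open Finset Function Equiv Equiv.Perm
open Literature.Combinatorics.Sahi2008 Literature.Combinatorics.Sahi2008.CycleForm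

namespace SahiAbsorbed

section Independent

open scoped Classical

variable {α : Type*} [Fintype α] (μ : α → ℝ) {n : ℕ} (f : Fin n → α → ℝ)

/-- The cycles of `σ` partition the index set: `Π_i Y_i = Π_{O ∈ cycles σ} Π_{i∈O} Y_i` (least-element representatives,
`SahiSlot.rep`). [this work] -/
theorem prod_eq_prod_orbits_indep {m : ℕ} (σ : Perm (Fin m)) (Y : Fin m → ℝ) :
    ∏ i, Y i = ∏ O ∈ orbits σ, ∏ i ∈ O, Y i := by
  have hfib : ∏ i, Y i = ∏ j, ∏ i ∈ univ.filter (fun i => SahiSlot.rep σ i = j), Y i := by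
    rw [← Finset.prod_fiberwise_of_maps_to (g := SahiSlot.rep σ) (t := univ) (fun i _ => mem_univ _)]
  rw [hfib, ← Finset.prod_filter_mul_prod_filter_not univ (fun j => SahiSlot.rep σ j = j)]
  have hnot : ∏ j ∈ univ.filter (fun j => ¬ SahiSlot.rep σ j = j),
      ∏ i ∈ univ.filter (fun i => SahiSlot.rep σ i = j), Y i = 1 := by
    refine prod_eq_one fun j hj => ?_
    rw [mem_filter] at hj
    have hemp : univ.filter (fun i => SahiSlot.rep σ i = j) = ∅ := by
      rw [Finset.filter_eq_empty_iff]
      intro i _ h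
      exact hj.2 (by rw [← h, SahiSlot.rep_rep])
    rw [hemp, prod_empty]
  rw [hnot, mul_one, SahiSlot.orbits_eq_image_reps, Finset.prod_image (SahiSlot.orbit_injOn_reps σ)]
  refine prod_congr rfl fun j hj => ?_
  rw [mem_filter] at hj
  have hfilt : univ.filter (fun i => SahiSlot.rep σ i = j) = orbit σ j := by
    ext i
    simp only [mem_filter, mem_univ, true_and, mem_orbit]
    exact SahiSlot.rep_eq_iff hj.2 i
  rw [hfilt]

/-- Under full moment factorisation, every cycle term is the product of the means. [this work] -/
theorem cycleE_eq_prod_ex_of_indep (hind : ∀ B : Finset (Fin n), ex μ (fun x => ∏ j ∈ B, f j x) = ∏ j ∈ B, ex μ (f j))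
    (σ : Perm (Fin n)) : cycleE μ f σ = ∏ j, ex μ (f j) := by
  unfold cycleE
  simp_rw [hind]
  exact (prod_eq_prod_orbits_indep σ (fun j => ex μ (f j))).symm

/-- The cycle terms of the all-ones family under a weight of mass one are `1`. [this work] -/
theorem cycleE_const_one (hμ : ∑ x, μ x = 1) (σ : Perm (Fin n)) : cycleE μ (fun _ : Fin n => fun _ : α => (1 : ℝ)) σ = 1 := by
  unfold cycleE
  refine prod_eq_one fun O _ => ?_
  rw [ex_def]
  simp [hμ]

/-- **`E_n(f) = (Π_j E[f_j]) · E_n(1,…,1)` for a fully independent family** (`n ≥ 1`, mass one). [this work] -/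
theorem sahiE_eq_prod_ex_mul_const (hμ : ∑ x, μ x = 1) (hn : 1 ≤ n)
    (hind : ∀ B : Finset (Fin n), ex μ (fun x => ∏ j ∈ B, f j x) = ∏ j ∈ B, ex μ (f j)) :
    sahiE μ n f = (∏ j, ex μ (f j)) * sahiE μ n (fun _ _ => (1 : ℝ)) := by
  rw [sahiE_eq_sahiECycle μ n hn f, sahiE_eq_sahiECycle μ n hn]
  unfold sahiECycle
  rw [mul_sum]
  refine sum_congr rfl fun σ _ => ?_
  rw [cycleE_eq_prod_ex_of_indep μ f hind σ, cycleE_const_one μ hμ σ]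
  ring

/-- **THE ALL-ORDER ZERO LOCUS (value level)**: `E_{n+2}(f) = 0` for a fully independent family under a weight of mass one. [this work] -/
theorem sahiE_eq_zero_of_indep (hμ : ∑ x, μ x = 1) (g : Fin (n + 2) → α → ℝ)
    (hind : ∀ B : Finset (Fin (n + 2)), ex μ (fun x => ∏ j ∈ B, g j x) = ∏ j ∈ B, ex μ (g j)) :
    sahiE μ (n + 2) g = 0 := by
  rw [sahiE_eq_prod_ex_mul_const μ g hμ (by omega) hind]
  have h1 : sahiE μ (n + 2) (fun (_ : Fin (n + 2)) (_ : α) => (1 : ℝ)) = 0 := sahiE_const_one hμ n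
  rw [h1, mul_zero]

end Independent

end SahiAbsorbed

end Summit.CriticalPhenomena.PercolationContinuityZ3.Theorems
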